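import Mathlib.Analysis.InnerProductSpace.Laplacian
import Literature.Analysis.FluidPDE.SwirlCutoff
import Literature.Analysis.FluidPDE.SereginZajaczkowski2007L42VorticityProofs
import HarnessLib

/-! # Calculus of cylindrical profiles off the axis — crux stmt-NavierStokesRegularity-14061 (`SymmetryModuliCount.AxisymEndLiouville`), line absorbing-axis-swirl-extinction, stub stub_cylProfileCalculus

Pure calculus on `ℝ³ = EuclideanSpace ℝ (Fin 3)`. For a profile `g : ℝ → ℝ` of class
`C²` on `(0, ∞)`, a scale `s > 0` and a point `x` off the axis (`r = cylRadius x ≠ 0`), the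
function `F(y) = g (r(y) / s)` is `C²` at `x`, its gradient is `(g'(ρ)/s) e_r` and its
Laplacian is the cylindrical Laplacian of an `r`-only function, `(g''(ρ) + g'(ρ)/ρ)/s²`,
`ρ = r/s`.

Proof. With `D r = ⟪e_r, ·⟫` off the axis (`hasFDerivAt_cylRadius`) the chain rule
gives `DF(y) a = s⁻¹ g'(r(y)/s) r(y)⁻¹ (y₀a₀ + y₁a₁)` near `x`; differentiating once more
at `x` (product rule, `D(r⁻¹) = -r⁻² ⟪e_r, ·⟫`),
`∂ₐ∂ₐF(x) = s⁻¹ [(g''(ρ)/s) r⁻² (x₀a₀ + x₁a₁)² - g'(ρ) r⁻³ (x₀a₀ + x₁a₁)²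
  + g'(ρ) r⁻¹ (a₀² + a₁²)]`,
and summing over the standard basis (`Σ (x₀a₀ + x₁a₁)² = r²`, `Σ (a₀² + a₁²) = 2`)
yields `ΔF(x) = g''(ρ)/s² + g'(ρ)/(r s) = (g''(ρ) + g'(ρ)/ρ)/s²` — the pattern of the tree's
`laplacian_inv_cylRadius` (`SereginZajaczkowski2007L42VorticityProofs`). The derivatives
`deriv g`, `deriv (deriv g)` are honest derivatives on the open set `(0, ∞)`
(`ContDiffOn.deriv_of_isOpen`). Everything is Mathlib plus the tree's `hasFDerivAt_cylRadius`,
`contDiffAt_cylRadius`, `cylRadius_sq`, `SereginZajaczkowski2007.inner_eR_left`,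
`SereginZajaczkowski2007.hasFDerivAt_inv_cylRadius`. -/

noncomputable section

-- the summit and its single problem share the name (D-0017 nested layout)
set_option linter.dupNamespace false

open Set Function Filter Topology MeasureTheory InnerProductSpace Metric
open scoped RealInnerProductSpace Laplacian ContDiff NNReal

namespace Summit.NavierStokesRegularity.NavierStokesRegularity.Theorems.AxisymEndLiouville.AbsorbingAxisSwirlExtinction

open Literature.Analysis.FluidPDE
open Literature.Analysis.FluidPDE.SereginZajaczkowski2007 (inner_eR_left hasFDerivAt_inv_cylRadius)

/-- `ℝ³` (local notation, as in the lead's skeleton, so that the registered stub signature is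
matched verbatim). -/
local notation "E3" => EuclideanSpace ℝ (Fin 3)

/-- A `C²` function on `(0, ∞)` has honest first and second derivatives at every `ρ > 0`:
`HasDerivAt g (g' ρ) ρ` and `HasDerivAt g' (g'' ρ) ρ` with `g' = deriv g`, `g'' = deriv g'`. -/
theorem hasDerivAt_of_contDiffOn_Ioi {g : ℝ → ℝ} (hg : ContDiffOn ℝ 2 g (Ioi 0)) {ρ : ℝ}
    (hρ : 0 < ρ) :
    HasDerivAt g (deriv g ρ) ρ ∧ HasDerivAt (deriv g) (deriv (deriv g) ρ) ρ := by
  have hmem : Ioi (0 : ℝ) ∈ 𝓝 ρ := Ioi_mem_nhds hρ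
  have h1 : DifferentiableOn ℝ g (Ioi 0) := hg.differentiableOn (by norm_num)
  have h2 : ContDiffOn ℝ 1 (deriv g) (Ioi 0) := hg.deriv_of_isOpen isOpen_Ioi (by norm_num)
  have h3 : DifferentiableOn ℝ (deriv g) (Ioi 0) := h2.differentiableOn (by norm_num)
  exact ⟨(h1.differentiableAt hmem).hasDerivAt, (h3.differentiableAt hmem).hasDerivAt⟩

/-- Off the axis the cylindrical radius is positive, hence so is `ρ = r/s` for `s > 0`. -/
theorem cylRadius_div_pos {y : EuclideanSpace ℝ (Fin 3)} (hy : cylRadius y ≠ 0) {s : ℝ}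
    (hs : 0 < s) : 0 < cylRadius y / s :=
  div_pos ((cylRadius_nonneg y).lt_of_ne' hy) hs

/-- **Chain rule for `y ↦ g (r(y)/s)` off the axis**: if `g` has derivative `g'` at
`r(y)/s`, then `D[g(r/s)](y) = (g'/s) ⟪e_r(y), ·⟫`. -/
theorem hasFDerivAt_comp_cylRadius_div {g : ℝ → ℝ} {g' s : ℝ} {y : EuclideanSpace ℝ (Fin 3)}
    (hy : cylRadius y ≠ 0) (hg : HasDerivAt g g' (cylRadius y / s)) :
    HasFDerivAt (fun z : EuclideanSpace ℝ (Fin 3) => g (cylRadius z / s))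
      ((g' / s) • innerSL ℝ (eR y)) y := by
  have h1 : HasDerivAt (fun t : ℝ => g (t / s)) (g' / s) (cylRadius y) := by
    refine (hg.comp (cylRadius y) ((hasDerivAt_id (cylRadius y)).div_const s)).congr_deriv ?_
    ring
  exact h1.comp_hasFDerivAt y (hasFDerivAt_cylRadius hy)

/-- STUB 6 of the line (calculus of cylindrical profiles off the axis).  For `g` of class
`C²` on `(0, ∞)` and `s > 0`, the function `y ↦ g (r(y)/s)` is `C²` near every off-axis point, with
gradient `(g'(ρ)/s) e_r` and Laplacian `(g''(ρ) + g'(ρ)/ρ)/s²`, `ρ = r/s`. -/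
theorem stub_cylProfileCalculus (g : ℝ → ℝ) (hg : ContDiffOn ℝ 2 g (Ioi 0)) (s : ℝ) (hs : 0 < s)
    (x : E3) (hx : cylRadius x ≠ 0) :
    ContDiffAt ℝ 2 (fun y => g (cylRadius y / s)) x ∧
      (∀ v, fderiv ℝ (fun y => g (cylRadius y / s)) x v =
        deriv g (cylRadius x / s) / s * ⟪eR x, v⟫) ∧
      (Δ (fun y => g (cylRadius y / s))) x =
        (deriv (deriv g) (cylRadius x / s) + deriv g (cylRadius x / s) / (cylRadius x / s)) /
          s ^ 2 := by
  have hs0 : s ≠ 0 := hs.ne'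
  have hρ : 0 < cylRadius x / s := cylRadius_div_pos hx hs
  obtain ⟨hg1, hg2⟩ := hasDerivAt_of_contDiffOn_Ioi hg hρ
  -- (a) smoothness at `x`
  have hF2 : ContDiffAt ℝ 2 (fun y : EuclideanSpace ℝ (Fin 3) => g (cylRadius y / s)) x :=
    (hg.contDiffAt (Ioi_mem_nhds hρ)).comp x ((contDiffAt_cylRadius hx).div_const s)
  refine ⟨hF2, fun v => ?_, ?_⟩
  · -- (b) the gradient
    rw [(hasFDerivAt_comp_cylRadius_div hx hg1).fderiv, _root_.smul_apply,
      innerSL_apply_apply, smul_eq_mul]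
  -- (c) the Laplacian, summed over the standard basis
  set F : EuclideanSpace ℝ (Fin 3) → ℝ := fun y => g (cylRadius y / s) with hFdef
  set b := EuclideanSpace.basisFun (Fin 3) ℝ with hb
  have hb' : ∀ i, b i = EuclideanSpace.single i 1 := fun i => by simp [hb]
  have hD : DifferentiableAt ℝ (fderiv ℝ F) x :=
    (hF2.fderiv_right (m := 1) le_rfl).differentiableAt one_ne_zero
  -- the directional derivatives near `x`
  have hU : ∀ᶠ y in 𝓝 x, cylRadius y ≠ 0 :=
    (isOpen_ne_fun continuous_cylRadius continuous_const).mem_nhds hx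
  have hdir : ∀ a : EuclideanSpace ℝ (Fin 3), (fun y => fderiv ℝ F y a) =ᶠ[𝓝 x]
      fun y => s⁻¹ * (deriv g (cylRadius y / s) *
        ((cylRadius y)⁻¹ * (y 0 * a 0 + y 1 * a 1))) := fun a => by
    filter_upwards [hU] with y hy
    rw [(hasFDerivAt_comp_cylRadius_div hy (hasDerivAt_of_contDiffOn_Ioi hg
      (cylRadius_div_pos hy hs)).1).fderiv, _root_.smul_apply, innerSL_apply_apply,
      smul_eq_mul, inner_eR_left]
    ring
  -- second directional derivatives at `x`
  have hsec : ∀ a : EuclideanSpace ℝ (Fin 3), fderiv ℝ (fun y => fderiv ℝ F y a) x a =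
      s⁻¹ * (deriv (deriv g) (cylRadius x / s) / s * (cylRadius x ^ 2)⁻¹ *
          (x 0 * a 0 + x 1 * a 1) ^ 2 -
        deriv g (cylRadius x / s) * (cylRadius x ^ 3)⁻¹ * (x 0 * a 0 + x 1 * a 1) ^ 2 +
        deriv g (cylRadius x / s) * (cylRadius x)⁻¹ * (a 0 ^ 2 + a 1 ^ 2)) := by
    intro a
    rw [(hdir a).fderiv_eq]
    have hA : HasFDerivAt (fun y : EuclideanSpace ℝ (Fin 3) => deriv g (cylRadius y / s))
        ((deriv (deriv g) (cylRadius x / s) / s) • innerSL ℝ (eR x)) x :=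
      hasFDerivAt_comp_cylRadius_div hx hg2
    have hB := hasFDerivAt_inv_cylRadius hx
    have hC : HasFDerivAt (fun y : EuclideanSpace ℝ (Fin 3) => y 0 * a 0 + y 1 * a 1)
        ((a 0) • (EuclideanSpace.proj (𝕜 := ℝ) (0 : Fin 3)) +
          (a 1) • (EuclideanSpace.proj (𝕜 := ℝ) (1 : Fin 3))) x :=
      ((EuclideanSpace.proj (𝕜 := ℝ) (0 : Fin 3)).hasFDerivAt.mul_const (a 0)).add
        ((EuclideanSpace.proj (𝕜 := ℝ) (1 : Fin 3)).hasFDerivAt.mul_const (a 1))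
    rw [((hA.fun_mul (hB.fun_mul hC)).const_mul s⁻¹).fderiv]
    simp only [_root_.add_apply, _root_.smul_apply, PiLp.proj_apply, innerSL_apply_apply,
      smul_eq_mul, inner_eR_left]
    field_simp
    ring
  -- assemble the Laplacian over the standard basis
  rw [InnerProductSpace.laplacian_eq_iteratedFDeriv_orthonormalBasis F b]
  have h1 : ∀ i, iteratedFDeriv ℝ 2 F x ![b i, b i] =
      fderiv ℝ (fun y => fderiv ℝ F y (b i)) x (b i) := fun i => by
    rw [iteratedFDeriv_two_apply, fderiv_clm_apply hD (differentiableAt_const _)]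
    simp
  simp only [Fin.sum_univ_three, h1, hsec]
  simp +decide only [hb', PiLp.single_apply, if_true, if_false]
  norm_num
  have hρ2 : x 0 ^ 2 + x 1 ^ 2 = cylRadius x ^ 2 := (cylRadius_sq x).symm
  field_simp
  linear_combination
    (cylRadius x * deriv (deriv g) (cylRadius x / s) - s * deriv g (cylRadius x / s)) * hρ2

end Summit.NavierStokesRegularity.NavierStokesRegularity.Theorems.AxisymEndLiouville.AbsorbingAxisSwirlExtinction

end
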